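import Mathlib.RingTheory.DedekindDomain.IntegralClosure
import Mathlib.FieldTheory.RatFunc.Basic
import Mathlib.FieldTheory.RatFunc.AsPolynomial
import Mathlib.RingTheory.AdjoinRoot
import Mathlib.RingTheory.Ideal.Over
import Literature.AnabelianGeometry.AbsoluteAnabelian.AbsTopIII.KummerFaithful
import HarnessLib

/-!
# [AbsTopIII] Rmk. 1.5.4 (i), "restricting to closed points": the Dedekind model of a function field of a curve

Proof-only companion (no new definitions) to `AbsTopIII/KummerFaithful.lean` (S. Mochizuki, *Topics in
Absolute Anabelian Geometry III*, §1, Rmk. 1.5.4 (i) p. 33, lit key `paper:url-5493eb38cbb7`): "one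
reduces immediately [...] to the case where `k` is a finitely generated extension of an MLF [...]. Then
by restricting to various closed points of this variety, one reduces to the case where `k` itself is an
MLF."  The kernel-shaped form of "this variety" used by the route of record for the last open part of
FACT-LIST row F-0369 (HOME/staging/f/f-083/g2/F0369-FG-ROUTE.md, junction J-a) is a CURVE: a finitely
generated field `L` of transcendence degree `d ≥ 1` over a base is a finite separable extension of
`F(X)` for a field `F` of transcendence degree `d − 1`, and the "variety" is `Spec` of the integral
closure `R` of `F[X]` in `L`.  This file proves, from Mathlib only, the four properties of `R` the
closed-point induction consumes:

* `isDedekindDomain_integralClosure_polynomial` — `R` is a Dedekind domain (so its localisations at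
  maximal ideals are discrete valuation rings and the tree's Néron-model library over Dedekind bases —
  `exists_abelianScheme_away_holds`, `isNeronModel_of_isProper_of_smooth` — applies);
* `isFractionRing_integralClosure_polynomial` — `Frac R = L`;
* `finite_quotient_integralClosure_polynomial` — every residue field `R ⧸ 𝔪` (`𝔪` maximal) is FINITE
  over `F` (so it has transcendence degree `d − 1`: the induction hypothesis, resp. for `d = 1` the MLF
  case, applies to the special fibres);
* `infinite_setOf_isMaximal_integralClosure_polynomial` — `R` has infinitely many maximal ideals
  (above the ideals `(X − a)`, `a ∈ F`, `F` infinite), so "various closed points" are infinitely many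
  even after removing the finitely many bad ones.

Classical commutative algebra (integral closure of a PID in a finite separable extension); nothing here
bears on [IUTchIII] Cor. 3.12; typed ≠ discharged.
-/

noncomputable section

open scoped Classical Polynomial

namespace Literature.AnabelianGeometry.AbsoluteAnabelian.AbsTopIII

universe u v

open Polynomial

variable {F : Type u} [Field F] {L : Type v} [Field L] [Algebra F[X] L] [Algebra (RatFunc F) L]
  [IsScalarTower F[X] (RatFunc F) L]

/-- The structure map `F[X] → L` of a field over `F(X)` is injective (it factors through the field
`F(X)`). [cite: MochizukiAbsTopIII2015, Rmk 1.5.4 (i) p.33] -/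
theorem algebraMap_polynomial_injective : Function.Injective (algebraMap F[X] L) := by
  rw [IsScalarTower.algebraMap_eq F[X] (RatFunc F) L]
  exact (algebraMap (RatFunc F) L).injective.comp (IsFractionRing.injective F[X] (RatFunc F))

variable [FiniteDimensional (RatFunc F) L] [Algebra.IsSeparable (RatFunc F) L]

/-- **The integral closure of `F[X]` in a finite separable extension `L` of `F(X)` is a Dedekind
domain** (Mathlib `integralClosure.isDedekindDomain`, `F[X]` being a principal ideal domain) — the
affine ring of "this variety" (a smooth curve over `F`) in [AbsTopIII] Rmk. 1.5.4 (i) p. 33.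
[cite: MochizukiAbsTopIII2015, Rmk 1.5.4 (i) p.33] -/
theorem isDedekindDomain_integralClosure_polynomial : IsDedekindDomain (integralClosure F[X] L) :=
  integralClosure.isDedekindDomain F[X] (RatFunc F) L

omit [Algebra.IsSeparable (RatFunc F) L] in
/-- The integral closure `R` of `F[X]` in `L` has fraction field `L` (Mathlib
`integralClosure.isFractionRing_of_finite_extension`). [cite: MochizukiAbsTopIII2015, Rmk 1.5.4 (i) p.33] -/
theorem isFractionRing_integralClosure_polynomial : IsFractionRing (integralClosure F[X] L) L :=
  integralClosure.isFractionRing_of_finite_extension (RatFunc F) L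

/-- The integral closure `R` of `F[X]` in `L` is a finite `F[X]`-module (Mathlib
`IsIntegralClosure.finite`: `F[X]` is integrally closed and Noetherian, `L / F(X)` finite separable).
[cite: MochizukiAbsTopIII2015, Rmk 1.5.4 (i) p.33] -/
theorem moduleFinite_integralClosure_polynomial : Module.Finite F[X] (integralClosure F[X] L) :=
  IsIntegralClosure.finite F[X] (RatFunc F) L (integralClosure F[X] L)

/-- A maximal ideal of `F[X]` has finite-dimensional residue field over `F` (it is generated by a
non-zero polynomial `q`, and `F[X]/(q)` has the power basis `1, X, …, X^{deg q − 1}`). Routine.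
[cite: MochizukiAbsTopIII2015, Rmk 1.5.4 (i) p.33] -/
theorem finiteDimensional_quotient_polynomial_of_isMaximal (𝔭 : Ideal F[X]) [h𝔭 : 𝔭.IsMaximal] :
    FiniteDimensional F (F[X] ⧸ 𝔭) := by
  have hne : 𝔭 ≠ ⊥ := Ring.ne_bot_of_isMaximal_of_not_isField h𝔭 (Polynomial.not_isField F)
  obtain ⟨q, hq⟩ := (IsPrincipalIdealRing.principal 𝔭).principal
  have hq0 : q ≠ 0 := by
    rintro rfl
    apply hne
    rw [hq]
    simp
  haveI : FiniteDimensional F (AdjoinRoot q) := (AdjoinRoot.powerBasis hq0).finite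
  have e : AdjoinRoot q ≃ₐ[F] F[X] ⧸ 𝔭 :=
    Ideal.quotientEquivAlgOfEq F (by rw [hq])
  exact Module.Finite.equiv e.toLinearEquiv

variable [Algebra F L] [IsScalarTower F F[X] L]

/-- **Every residue field of the Dedekind model is finite over the constant field**: for a maximal
ideal `𝔪` of the integral closure `R` of `F[X]` in `L`, the residue field `R ⧸ 𝔪` is finite-dimensional
over `F` — `R` is a finite `F[X]`-module and `𝔪 ∩ F[X]` is a maximal (non-zero) ideal of `F[X]`.  In
[AbsTopIII] Rmk. 1.5.4 (i) p. 33 this is why "restricting to [...] closed points" lands in fields of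
transcendence degree one less (for a curve over an MLF: in MLF's).
[cite: MochizukiAbsTopIII2015, Rmk 1.5.4 (i) p.33] -/
theorem finite_quotient_integralClosure_polynomial (𝔪 : Ideal (integralClosure F[X] L))
    [h𝔪 : 𝔪.IsMaximal] : Module.Finite F (integralClosure F[X] L ⧸ 𝔪) := by
  haveI : Module.Finite F[X] (integralClosure F[X] L) := moduleFinite_integralClosure_polynomial
  -- `R ⧸ 𝔪` is a finite `F[X]`-module
  haveI hfin : Module.Finite F[X] (integralClosure F[X] L ⧸ 𝔪) :=
    Module.Finite.of_surjective (Ideal.Quotient.mkₐ F[X] 𝔪).toLinearMap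
      (Ideal.Quotient.mkₐ_surjective F[X] 𝔪)
  -- the contraction `𝔭 = 𝔪 ∩ F[X]` is maximal, with finite residue field over `F`
  haveI h𝔭 : (𝔪.comap (algebraMap F[X] (integralClosure F[X] L))).IsMaximal :=
    Ideal.IsMaximal.under F[X] 𝔪
  haveI : FiniteDimensional F (F[X] ⧸ 𝔪.comap (algebraMap F[X] (integralClosure F[X] L))) :=
    finiteDimensional_quotient_polynomial_of_isMaximal _
  -- `R ⧸ 𝔪` is a finite module over `F[X] ⧸ 𝔭`, and `F → F[X] ⧸ 𝔭 → R ⧸ 𝔪` is a tower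
  haveI : Module.Finite (F[X] ⧸ 𝔪.comap (algebraMap F[X] (integralClosure F[X] L)))
      (integralClosure F[X] L ⧸ 𝔪) :=
    Module.Finite.of_restrictScalars_finite F[X]
      (F[X] ⧸ 𝔪.comap (algebraMap F[X] (integralClosure F[X] L))) (integralClosure F[X] L ⧸ 𝔪)
  haveI : IsScalarTower F (F[X] ⧸ 𝔪.comap (algebraMap F[X] (integralClosure F[X] L)))
      (integralClosure F[X] L ⧸ 𝔪) :=
    IsScalarTower.of_algebraMap_eq (R := F)
      (S := F[X] ⧸ 𝔪.comap (algebraMap F[X] (integralClosure F[X] L)))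
      (A := integralClosure F[X] L ⧸ 𝔪) fun c => by
      have h1 : algebraMap F (integralClosure F[X] L ⧸ 𝔪) c =
          Ideal.Quotient.mk 𝔪 (algebraMap F[X] (integralClosure F[X] L) (algebraMap F F[X] c)) := by
        rw [IsScalarTower.algebraMap_apply F F[X] (integralClosure F[X] L ⧸ 𝔪) c,
          ← Ideal.Quotient.mk_algebraMap]
      have h2 : algebraMap F (F[X] ⧸ 𝔪.comap (algebraMap F[X] (integralClosure F[X] L))) c =
          Ideal.Quotient.mk _ (algebraMap F F[X] c) := by
        rw [IsScalarTower.algebraMap_apply F F[X] (F[X] ⧸ 𝔪.comap (algebraMap F[X] _)) c,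
          Ideal.Quotient.algebraMap_eq]
      rw [h1, h2]
      exact (Ideal.quotientMap_mk (I := 𝔪) (f := algebraMap F[X] (integralClosure F[X] L))
        (H := le_rfl) (x := algebraMap F F[X] c)).symm
  exact Module.Finite.trans (F[X] ⧸ 𝔪.comap (algebraMap F[X] (integralClosure F[X] L)))
    (integralClosure F[X] L ⧸ 𝔪)

omit [FiniteDimensional (RatFunc F) L] [Algebra.IsSeparable (RatFunc F) L] [Algebra F L]
  [IsScalarTower F F[X] L] in
/-- **The Dedekind model has infinitely many closed points**: for an infinite field `F`, the integral
closure `R` of `F[X]` in `L` has infinitely many maximal ideals — above each of the pairwise distinct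
maximal ideals `(X − a)`, `a ∈ F`, of `F[X]` lies a maximal ideal of the integral extension `R`
(lying over).  "Various closed points", [AbsTopIII] Rmk. 1.5.4 (i) p. 33.
[cite: MochizukiAbsTopIII2015, Rmk 1.5.4 (i) p.33] -/
theorem infinite_setOf_isMaximal_integralClosure_polynomial [Infinite F] :
    {𝔪 : Ideal (integralClosure F[X] L) | 𝔪.IsMaximal}.Infinite := by
  set R := integralClosure F[X] L with hR
  have hker : RingHom.ker (algebraMap F[X] R) = ⊥ := by
    rw [RingHom.ker_eq_bot_iff_eq_zero]
    intro q hq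
    apply algebraMap_polynomial_injective (F := F) (L := L)
    rw [map_zero, IsScalarTower.algebraMap_apply F[X] R L, hq, map_zero]
  -- above `(X - a)` lies a maximal ideal `M a` of `R`
  have hex : ∀ a : F, ∃ M : Ideal R, M.IsMaximal ∧
      M.comap (algebraMap F[X] R) = Ideal.span {X - C a} := by
    intro a
    haveI : (Ideal.span {X - C a} : Ideal F[X]).IsMaximal :=
      PrincipalIdealRing.isMaximal_of_irreducible (Polynomial.irreducible_X_sub_C a)
    exact Ideal.exists_ideal_over_maximal_of_isIntegral (Ideal.span {X - C a}) (by rw [hker]; exact bot_le)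
  choose M hMmax hMcomap using hex
  refine Set.infinite_of_injective_forall_mem (f := M) (fun a b hab => ?_) (fun a => hMmax a)
  -- `M a = M b` forces `(X - a) = (X - b)`, hence `a = b`
  have h1 : (Ideal.span {X - C a} : Ideal F[X]) = Ideal.span {X - C b} := by
    rw [← hMcomap a, ← hMcomap b, hab]
  have h2 : X - C a ∈ (Ideal.span {X - C b} : Ideal F[X]) := h1 ▸ Ideal.mem_span_singleton_self _
  obtain ⟨r, hr⟩ := Ideal.mem_span_singleton'.mp h2
  have h3 := congrArg (Polynomial.eval b) hr
  simp only [eval_mul, eval_sub, eval_X, eval_C, sub_self, mul_zero] at h3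
  exact (sub_eq_zero.mp h3.symm).symm

end Literature.AnabelianGeometry.AbsoluteAnabelian.AbsTopIII
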